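import Mathlib
import Summits.NavierStokesRegularity.NavierStokesRegularity.Theorems.TaoLadderRungTwoFlatTruncatedHopAnchored
import HarnessLib

/-!
# The CORE a-priori bound DURING a hop from the history of the two interface amplitudes (flat dynamics, `λ₀ = 1`)
  (helper for the K_A♭ parent item stmt-NavierStokesRegularity-22987 `FlatGapCertificatesV2`, children 1A/2A of route
  TaoLadderRungTwoFlat; cell harvest/h2-tao-ladder, p1 g22; the `near → core` link of the joint per-hop bootstrap,
  LADDER §49.5 (b), `HopTube.TubeStepCore` / `…Theorems.Bootstrap.Icc_induction₂`)

The joint per-hop argument of the typed frame `H(n)` runs a continuous induction (`…Theorems.Bootstrap`) on two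
quantities: the co-moving near energy `V(t)` and the core gauge deviation. This file is the link "history of the near
edge amplitude and of the core deviation just above the edge ⇒ core gauge deviation now", for two GLOBAL solutions of the
flat mirror lattice `T♭(ε)` (the hop flow `X` and the pulse `Φ`, scale `1`): with `u = X − Φ`, `η = truncFam e u` (the
deviation truncated below the edge shell `e`), the truncated deviation solves the FORCED deviation equation
(`hasDerivAt_truncFam`) whose forcing lives on the two interface sites and is bounded by
`c_e|q_e|(2|V_e| + |q_e| + ε(|A_{e+1}| + |p_{e+1}|))` (carrier of `e+1`) and `c_e|p_{e+1}|(|V_e| + ε(2|A_{e+1}| + |p_{e+1}|))`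
(bond of `e`) (`abs_interfaceForcing_carrier_le` / `_bond_le`). Hence, by the tree's gauge Grönwall with forcing
(`QuadPolar.gauge_forced_deviation_bound`, gauge `geomGauge g b`, `Λ = max g b`):

* `core_apriori_flat` — if on `[0, T]` the pulse is `≤ η̂` at the two interface values (`|Φ_{1,e}|, |Φ_{0,e+1}| ≤ η̂`: the
  pulse TAIL at depth `K`), the near deviation at the edge shell is `≤ q̄` (`|u_{1,e}| ≤ q̄`, from the near energy via
  `abs_behind_le_of_coMovingEnergyOn`) and the core deviation just above it is `≤ r̄` (`|u_{0,e+1}| ≤ r̄`, the bootstrap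
  assumption), then for every site and every `s ∈ [0, T]`
  `ω_{i,k}|η_{i,k}(s)| ≤ (B + F·s)·e^{2‖T♭‖₁ M (max g b) s}`,
  `F = ω_{0,e+1}·q̄(2η̂ + q̄ + ε(η̂ + r̄)) + ω_{1,e}·r̄(η̂ + ε(2η̂ + r̄))`, `B` the initial core gauge data;
* `core_apriori_flat_interface` — in particular at the interface carrier: `ω_{0,e+1}|u_{0,e+1}(s)| ≤ (B + F s)e^{…}`
  (the quantity the bootstrap improves: `r̄` enters `F` with the small factor `η̂`).

HONEST FRAMING: a conditional finite-time estimate about a MODEL lattice (Tao 2016 §4 vocabulary on `S♭`, flat clocks);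
all bounds are HYPOTHESES; nothing certified; nothing about the Navier–Stokes equations.
-/

noncomputable section

-- the sub-problem namespace repeats the summit name by design (D-0017)
set_option linter.dupNamespace false

namespace Summit.NavierStokesRegularity.NavierStokesRegularity.Theorems

open Set Filter Literature.Analysis.FluidPDE Literature.Analysis.FluidPDE.TaoCascade QuadPolar
open scoped Topology

namespace MirrorPulse

/-- **CORE A-PRIORI BOUND DURING THE HOP (flat, scale 1).** See the module docstring.
[cite: Tao2016AveragedNS, §4 Lemma 4.1 (4.8) (statement shape: finite-time control of the lattice flow); route TaoLadderRungTwoFlat, L8b-3 localisation + gauge Grönwall (LADDER §49.5 (b)), `near → core` link of the per-hop bootstrap] -/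
theorem core_apriori_flat {ε : ℝ} {Φ X : Fin 2 → ℤ → ℝ → ℝ} {g b M B ηhat qbar rbar T : ℝ} {e : ℤ}
    (hΦ : IsGlobalSol ε Φ) (hX : IsGlobalSol ε X) (hε : 0 ≤ ε)
    (hΦb : ∀ i n t, |Φ i n t| ≤ M) (hXb : ∀ i n t, |X i n t| ≤ M) (hg : 1 ≤ g) (hb : 1 ≤ b)
    (hB : ∀ i k, geomGauge g b i k * |truncFam e (X - Φ) i k 0| ≤ B)
    (hVe : ∀ t ∈ Icc 0 T, |Φ 1 e t| ≤ ηhat) (hAe : ∀ t ∈ Icc 0 T, |Φ 0 (e + 1) t| ≤ ηhat) (hηhat : 0 ≤ ηhat)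
    (hq : ∀ t ∈ Icc 0 T, |(X - Φ) 1 e t| ≤ qbar) (hqbar : 0 ≤ qbar)
    (hr : ∀ t ∈ Icc 0 T, |(X - Φ) 0 (e + 1) t| ≤ rbar) (hrbar : 0 ≤ rbar)
    (i : Fin 2) (k : ℤ) {s : ℝ} (hs : s ∈ Icc 0 T) :
    geomGauge g b i k * |truncFam e (X - Φ) i k s|
      ≤ (B + (geomGauge g b 0 (e + 1) * (qbar * (2 * ηhat + qbar + ε * (ηhat + rbar)))
            + geomGauge g b 1 e * (rbar * (ηhat + ε * (2 * ηhat + rbar)))) * s)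
        * Real.exp (2 * tableAbsSum shiftSetFlat (mirrorTable ε ε) * M * max g b * s) := by
  set u : Fin 2 → ℤ → ℝ → ℝ := X - Φ with hu
  set η : Fin 2 → ℤ → ℝ → ℝ := truncFam e u with hηdef
  set f : Fin 2 → ℤ → ℝ → ℝ := interfaceForcing ε 0 e Φ u with hf
  set F₀ : ℝ := geomGauge g b 0 (e + 1) * (qbar * (2 * ηhat + qbar + ε * (ηhat + rbar))) with hF₀
  set F₁ : ℝ := geomGauge g b 1 e * (rbar * (ηhat + ε * (2 * ηhat + rbar))) with hF₁
  have hΦu : Φ + u = X := by rw [hu]; abel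
  have hω : IsWindowRegular (geomGauge g b) (max g b) := isWindowRegular_geomGauge hg hb
  have hωpos : ∀ j n, 0 < geomGauge g b j n := fun j n => geomGauge_pos (by linarith) (by linarith) j n
  have hΦc : ∀ j n, Continuous (Φ j n) := fun j n => hΦ.continuous j n
  have huc : ∀ j n, Continuous (u j n) := fun j n => by
    have h : Continuous fun t => X j n t - Φ j n t := (hX.continuous j n).sub (hΦ.continuous j n)
    exact h
  have hηc : ∀ j n, Continuous (η j n) := continuous_truncFam huc
  have hXb' : ∀ j n t, |(Φ + u) j n t| ≤ M := by rw [hΦu]; exact hXb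
  have hXηb : ∀ j n t, |(Φ + η) j n t| ≤ M := abs_add_truncFam_le hΦb hXb'
  have hfc : ∀ j n, Continuous (f j n) := continuous_interfaceForcing hΦc huc
  have hηd : ∀ j n t, HasDerivAt (η j n)
      (quadTermOn shiftSetFlat 0 (mirrorTable ε ε) (Φ + η) j n t
        - quadTermOn shiftSetFlat 0 (mirrorTable ε ε) Φ j n t + f j n t) t := by
    intro j n t
    refine hasDerivAt_truncFam (fun j' k' => hΦ j' k' t) (fun j' k' => ?_) j n
    rw [hΦu]; exact hX j' k' t
  -- the forcing bound in the gauge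
  have hF₀0 : 0 ≤ F₀ := by rw [hF₀]; have := (hωpos 0 (e + 1)).le; positivity
  have hF₁0 : 0 ≤ F₁ := by rw [hF₁]; have := (hωpos 1 e).le; positivity
  have hF : 0 ≤ F₀ + F₁ := add_nonneg hF₀0 hF₁0
  have hc0 : ∀ n : ℤ, clock 0 n = 1 := fun n => by unfold clock; simp
  have hfb : ∀ j n, ∀ t ∈ Icc 0 T, geomGauge g b j n * |f j n t| ≤ F₀ + F₁ := by
    intro j n t ht
    have hqe := hq t ht
    have hre := hr t ht
    have hVt := hVe t ht
    have hAt := hAe t ht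
    by_cases h0 : j = 0 ∧ n = e + 1
    · obtain ⟨rfl, rfl⟩ := h0
      have h := abs_interfaceForcing_carrier_le hε (by norm_num : (-1 : ℝ) ≤ 0) e Φ u t
      rw [hc0, one_mul] at h
      have h2 : |u 1 e t| * (2 * |Φ 1 e t| + |u 1 e t| + ε * (|Φ 0 (e + 1) t| + |u 0 (e + 1) t|))
          ≤ qbar * (2 * ηhat + qbar + ε * (ηhat + rbar)) := by
        have hin : 2 * |Φ 1 e t| + |u 1 e t| + ε * (|Φ 0 (e + 1) t| + |u 0 (e + 1) t|)
            ≤ 2 * ηhat + qbar + ε * (ηhat + rbar) := by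
          have := mul_le_mul_of_nonneg_left (add_le_add hAt hre) hε
          linarith
        exact mul_le_mul hqe hin (by positivity) hqbar
      calc geomGauge g b 0 (e + 1) * |f 0 (e + 1) t|
          ≤ geomGauge g b 0 (e + 1) * (qbar * (2 * ηhat + qbar + ε * (ηhat + rbar))) :=
            mul_le_mul_of_nonneg_left (h.trans h2) (hωpos 0 (e + 1)).le
        _ = F₀ := by rw [hF₀]
        _ ≤ F₀ + F₁ := le_add_of_nonneg_right hF₁0
    by_cases h1 : j = 1 ∧ n = e
    · obtain ⟨rfl, rfl⟩ := h1
      have h := abs_interfaceForcing_bond_le hε (by norm_num : (-1 : ℝ) ≤ 0) n Φ u t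
      rw [hc0, one_mul] at h
      have h2 : |u 0 (n + 1) t| * (|Φ 1 n t| + ε * (2 * |Φ 0 (n + 1) t| + |u 0 (n + 1) t|))
          ≤ rbar * (ηhat + ε * (2 * ηhat + rbar)) := by
        have hin : |Φ 1 n t| + ε * (2 * |Φ 0 (n + 1) t| + |u 0 (n + 1) t|) ≤ ηhat + ε * (2 * ηhat + rbar) := by
          have h3 : 2 * |Φ 0 (n + 1) t| + |u 0 (n + 1) t| ≤ 2 * ηhat + rbar := by linarith
          have := mul_le_mul_of_nonneg_left h3 hε
          linarith
        exact mul_le_mul hre hin (by positivity) hrbar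
      calc geomGauge g b 1 n * |f 1 n t|
          ≤ geomGauge g b 1 n * (rbar * (ηhat + ε * (2 * ηhat + rbar))) :=
            mul_le_mul_of_nonneg_left (h.trans h2) (hωpos 1 n).le
        _ = F₁ := by rw [hF₁]
        _ ≤ F₀ + F₁ := le_add_of_nonneg_left hF₀0
    · have hz : f j n t = 0 := interfaceForcing_eq_zero ε 0 Φ u h0 h1 t
      rw [hz, abs_zero, mul_zero]
      exact hF
  -- gauge Grönwall with forcing
  have hmain := gauge_forced_deviation_bound isNearestNeighbourSet_shiftSetFlat (mirrorTable ε ε) hω hΦc hηc hΦb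
    hXηb hfc hfb hF hηd hB i k hs
  simpa only [hF₀, hF₁] using hmain

/-- **At the interface carrier**: under the hypotheses of `core_apriori_flat`, the core deviation just above the edge obeys
`ω_{0,e+1}|u_{0,e+1}(s)| ≤ (B + F s)e^{2‖T♭‖₁M(max g b)s}` on `[0, T]` — the bootstrap's improvement step for `r̄` (which
enters `F` only through the pulse-tail factor `η̂` and `ε`). [cite: Tao2016AveragedNS, §4 Lemma 4.1 (4.8) (statement shape); route TaoLadderRungTwoFlat, LADDER §49.5 (b), per-hop bootstrap] -/
theorem core_apriori_flat_interface {ε : ℝ} {Φ X : Fin 2 → ℤ → ℝ → ℝ} {g b M B ηhat qbar rbar T : ℝ} {e : ℤ}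
    (hΦ : IsGlobalSol ε Φ) (hX : IsGlobalSol ε X) (hε : 0 ≤ ε)
    (hΦb : ∀ i n t, |Φ i n t| ≤ M) (hXb : ∀ i n t, |X i n t| ≤ M) (hg : 1 ≤ g) (hb : 1 ≤ b)
    (hB : ∀ i k, geomGauge g b i k * |truncFam e (X - Φ) i k 0| ≤ B)
    (hVe : ∀ t ∈ Icc 0 T, |Φ 1 e t| ≤ ηhat) (hAe : ∀ t ∈ Icc 0 T, |Φ 0 (e + 1) t| ≤ ηhat) (hηhat : 0 ≤ ηhat)
    (hq : ∀ t ∈ Icc 0 T, |(X - Φ) 1 e t| ≤ qbar) (hqbar : 0 ≤ qbar)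
    (hr : ∀ t ∈ Icc 0 T, |(X - Φ) 0 (e + 1) t| ≤ rbar) (hrbar : 0 ≤ rbar)
    {s : ℝ} (hs : s ∈ Icc 0 T) :
    geomGauge g b 0 (e + 1) * |(X - Φ) 0 (e + 1) s|
      ≤ (B + (geomGauge g b 0 (e + 1) * (qbar * (2 * ηhat + qbar + ε * (ηhat + rbar)))
            + geomGauge g b 1 e * (rbar * (ηhat + ε * (2 * ηhat + rbar)))) * s)
        * Real.exp (2 * tableAbsSum shiftSetFlat (mirrorTable ε ε) * M * max g b * s) := by
  have h := core_apriori_flat hΦ hX hε hΦb hXb hg hb hB hVe hAe hηhat hq hqbar hr hrbar 0 (e + 1) hs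
  rwa [truncFam_of_le le_rfl] at h

end MirrorPulse

end Summit.NavierStokesRegularity.NavierStokesRegularity.Theorems

end
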